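import Mathlib

set_option Elab.async false  -- synchronous elaboration: bounded memory on the check farm

/-! # Decomp6 — decomposition census of (eq2)-multisets of CM types for 3 infinite places (degree 6), ALL sizes (seat p4 g3)

A CM type of a CM field with `3` infinite places is encoded (one embedding fixed per place) as a sign vector in
`{±1}^3`, here as an index `i < 8` (bit `j` of `i` set ⟺ coordinate `j` is `+1`); the conjugate type is `7 - i`.
A multiset of types is a multiplicity function (here the `8` variables `n0 … n7`); Pohlmann/Deligne's (eq2) —
every embedding in exactly half of the types — is `ZeroSum`: for every coordinate `j`, Σ_{bit j set} n i = Σ_{bit j unset} n i.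
The corner product of a zero-sum multiset is a split-Weil variety, and when the multiset is the disjoint union of two
zero-sum multisets its Weil line is the product of the two Weil lines (ROUTE.md §3.6); so a closer must handle the
INDECOMPOSABLE zero-sum multisets.  `domination` says: every nonzero zero-sum multiset dominates (contains) one of the
`6` basis multisets listed as the constructors of `Dom` — an antipodal pair `{T, T̄}` (size 2, `4`), a face
(size 4, `2`).  Hence every indecomposable zero-sum multiset
is one of them, for EVERY size (an indecomposable `n` dominates a basis element `b`; `n - b` is zero-sum, so `n = b`):
the Hilbert bases of the transversal cones are exactly the listed elements.  Method: without an antipodal pair the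
support lies in a transversal (one vector per antipodal pair); per transversal the claim is linear arithmetic (`omega`),
proved for one representative of each of the `3` orbits of the hyperoctahedral group `B_3` on the `16`
transversals and transported to the others by renaming the variables at the leaves of a case tree over the antipodal
pairs.  Python mirrors (Contejean–Devie Hilbert-basis completion; bounded enumeration) in the p4 g3 session folder
work/decomp/. -/

namespace HodgeRepro.P4.Decomp6

/-- `n = 0 ∨ 0 < n` (alias of `Nat.eq_zero_or_pos`, used by the case trees). -/
theorem zp (n : ℕ) : n = 0 ∨ 0 < n := Nat.eq_zero_or_pos n

/-- (eq2): the multiset `n0 … n7` has zero sum in each of the `3` coordinates. -/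
abbrev ZeroSum (n0 n1 n2 n3 n4 n5 n6 n7 : ℕ) : Prop :=
  n1 + n3 + n5 + n7 = n0 + n2 + n4 + n6 ∧
  n2 + n3 + n6 + n7 = n0 + n1 + n4 + n5 ∧
  n4 + n5 + n6 + n7 = n0 + n1 + n2 + n3

/-- The hypotheses of `domination`: (eq2) and nonzero. -/
abbrev Hyp (n0 n1 n2 n3 n4 n5 n6 n7 : ℕ) : Prop := ZeroSum n0 n1 n2 n3 n4 n5 n6 n7 ∧ 0 < n0 + n1 + n2 + n3 + n4 + n5 + n6 + n7

/-- `Dom n` : the multiset `n` dominates one of the `6` basis multisets (one constructor each). -/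
inductive Dom (n0 n1 n2 n3 n4 n5 n6 n7 : ℕ) : Prop
  | pair0 (h : 1 ≤ n0 ∧ 1 ≤ n7) : Dom n0 n1 n2 n3 n4 n5 n6 n7
  | pair1 (h : 1 ≤ n1 ∧ 1 ≤ n6) : Dom n0 n1 n2 n3 n4 n5 n6 n7
  | pair2 (h : 1 ≤ n2 ∧ 1 ≤ n5) : Dom n0 n1 n2 n3 n4 n5 n6 n7
  | pair3 (h : 1 ≤ n3 ∧ 1 ≤ n4) : Dom n0 n1 n2 n3 n4 n5 n6 n7
  | face0 (h : 1 ≤ n0 ∧ 1 ≤ n3 ∧ 1 ≤ n5 ∧ 1 ≤ n6) : Dom n0 n1 n2 n3 n4 n5 n6 n7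
  | face1 (h : 1 ≤ n1 ∧ 1 ≤ n2 ∧ 1 ≤ n4 ∧ 1 ≤ n7) : Dom n0 n1 n2 n3 n4 n5 n6 n7

/-- Transversal `[0, 1, 2, 3]` (orbit representative; cone with 0 Hilbert-basis element(s)): a nonzero zero-sum
multiset supported on it dominates a basis element. -/
theorem t0 (m0 m1 m2 m3 : ℕ) (_e0 : m1 + m3 = m0 + m2) (_e1 : m2 + m3 = m0 + m1) (_e2 : 0 = m0 + m1 + m2 + m3) (_hne : 0 < m0 + m1 + m2 + m3) :
    False := by
  omega

/-- Transversal `[0, 1, 2, 4]` (orbit representative; cone with 0 Hilbert-basis element(s)): a nonzero zero-sum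
multiset supported on it dominates a basis element. -/
theorem t1 (m0 m1 m2 m3 : ℕ) (_e0 : m1 = m0 + m2 + m3) (_e1 : m2 = m0 + m1 + m3) (_e2 : m3 = m0 + m1 + m2) (_hne : 0 < m0 + m1 + m2 + m3) :
    False := by
  omega

/-- Transversal `[0, 3, 5, 6]` (orbit representative; cone with 1 Hilbert-basis element(s)): a nonzero zero-sum
multiset supported on it dominates a basis element. -/
theorem t6 (m0 m1 m2 m3 : ℕ) (_e0 : m1 + m2 = m0 + m3) (_e1 : m1 + m3 = m0 + m2) (_e2 : m2 + m3 = m0 + m1) (_hne : 0 < m0 + m1 + m2 + m3) :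
    (1 ≤ m0 ∧ 1 ≤ m1 ∧ 1 ≤ m2 ∧ 1 ≤ m3) := by
  omega

/-- **Domination theorem, 3 places (degree 6).** Every nonzero zero-sum multiset of sign vectors in `{±1}^3` dominates
an antipodal pair, a face (the constructors of `Dom`).  Consequently the indecomposable zero-sum multisets are
exactly these `6`, of sizes 2, 4 — for every size. -/
theorem domination (n0 n1 n2 n3 n4 n5 n6 n7 : ℕ) (hz : Hyp n0 n1 n2 n3 n4 n5 n6 n7) : Dom n0 n1 n2 n3 n4 n5 n6 n7 := by
  obtain ⟨⟨h0, h1, h2⟩, hne⟩ := hz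
  rcases zp n0 with ha0 | ha0
  · rcases zp n1 with ha1 | ha1
    · rcases zp n2 with ha2 | ha2
      · rcases zp n3 with ha3 | ha3
        · subst ha0 ha1 ha2 ha3
          have key := t0 n4 n5 n6 n7 (by omega) (by omega) (by omega) (by omega)
          exact key.elim
        · rcases zp n4 with hb3 | hb3
          · subst ha0 ha1 ha2 hb3
            have key := t1 n7 n6 n5 n3 (by omega) (by omega) (by omega) (by omega)
            exact key.elim
          · exact Dom.pair3 ⟨ha3, hb3⟩
      · rcases zp n5 with hb2 | hb2
        · rcases zp n3 with ha3 | ha3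
          · subst ha0 ha1 hb2 ha3
            have key := t1 n6 n7 n4 n2 (by omega) (by omega) (by omega) (by omega)
            exact key.elim
          · rcases zp n4 with hb3 | hb3
            · subst ha0 ha1 hb2 hb3
              have key := t0 n2 n3 n6 n7 (by omega) (by omega) (by omega) (by omega)
              exact key.elim
            · exact Dom.pair3 ⟨ha3, hb3⟩
        · exact Dom.pair2 ⟨ha2, hb2⟩
    · rcases zp n6 with hb1 | hb1
      · rcases zp n2 with ha2 | ha2
        · rcases zp n3 with ha3 | ha3
          · subst ha0 hb1 ha2 ha3
            have key := t1 n5 n4 n7 n1 (by omega) (by omega) (by omega) (by omega)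
            exact key.elim
          · rcases zp n4 with hb3 | hb3
            · subst ha0 hb1 ha2 hb3
              have key := t0 n1 n3 n5 n7 (by omega) (by omega) (by omega) (by omega)
              exact key.elim
            · exact Dom.pair3 ⟨ha3, hb3⟩
        · rcases zp n5 with hb2 | hb2
          · rcases zp n3 with ha3 | ha3
            · subst ha0 hb1 hb2 ha3
              have key := t6 n4 n7 n1 n2 (by omega) (by omega) (by omega) (by omega)
              exact Dom.face1 (by omega)
            · rcases zp n4 with hb3 | hb3
              · subst ha0 hb1 hb2 hb3
                have key := t1 n3 n2 n1 n7 (by omega) (by omega) (by omega) (by omega)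
                exact key.elim
              · exact Dom.pair3 ⟨ha3, hb3⟩
          · exact Dom.pair2 ⟨ha2, hb2⟩
      · exact Dom.pair1 ⟨ha1, hb1⟩
  · rcases zp n7 with hb0 | hb0
    · rcases zp n1 with ha1 | ha1
      · rcases zp n2 with ha2 | ha2
        · rcases zp n3 with ha3 | ha3
          · subst hb0 ha1 ha2 ha3
            have key := t1 n4 n5 n6 n0 (by omega) (by omega) (by omega) (by omega)
            exact key.elim
          · rcases zp n4 with hb3 | hb3
            · subst hb0 ha1 ha2 hb3
              have key := t6 n0 n3 n5 n6 (by omega) (by omega) (by omega) (by omega)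
              exact Dom.face0 (by omega)
            · exact Dom.pair3 ⟨ha3, hb3⟩
        · rcases zp n5 with hb2 | hb2
          · rcases zp n3 with ha3 | ha3
            · subst hb0 ha1 hb2 ha3
              have key := t0 n0 n2 n4 n6 (by omega) (by omega) (by omega) (by omega)
              exact key.elim
            · rcases zp n4 with hb3 | hb3
              · subst hb0 ha1 hb2 hb3
                have key := t1 n2 n3 n0 n6 (by omega) (by omega) (by omega) (by omega)
                exact key.elim
              · exact Dom.pair3 ⟨ha3, hb3⟩
          · exact Dom.pair2 ⟨ha2, hb2⟩
      · rcases zp n6 with hb1 | hb1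
        · rcases zp n2 with ha2 | ha2
          · rcases zp n3 with ha3 | ha3
            · subst hb0 hb1 ha2 ha3
              have key := t0 n0 n1 n4 n5 (by omega) (by omega) (by omega) (by omega)
              exact key.elim
            · rcases zp n4 with hb3 | hb3
              · subst hb0 hb1 ha2 hb3
                have key := t1 n1 n0 n3 n5 (by omega) (by omega) (by omega) (by omega)
                exact key.elim
              · exact Dom.pair3 ⟨ha3, hb3⟩
          · rcases zp n5 with hb2 | hb2
            · rcases zp n3 with ha3 | ha3
              · subst hb0 hb1 hb2 ha3
                have key := t1 n0 n1 n2 n4 (by omega) (by omega) (by omega) (by omega)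
                exact key.elim
              · rcases zp n4 with hb3 | hb3
                · subst hb0 hb1 hb2 hb3
                  have key := t0 n0 n1 n2 n3 (by omega) (by omega) (by omega) (by omega)
                  exact key.elim
                · exact Dom.pair3 ⟨ha3, hb3⟩
            · exact Dom.pair2 ⟨ha2, hb2⟩
        · exact Dom.pair1 ⟨ha1, hb1⟩
    · exact Dom.pair0 ⟨ha0, hb0⟩

end HodgeRepro.P4.Decomp6
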